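import Literature.NumberTheory.Sieve.AsymptoticSieveForPrimesTheorem2
import HarnessLib

/-!
# Friedlander–Iwaniec, *The polynomial `X² + Y⁴` captures its primes*: Proposition 2.1 discharged

Family `parity`, sibling ("Proofs") file of `Literature.NumberTheory.Sieve.FriedlanderIwaniecPrimes`.
Source: J. Friedlander, H. Iwaniec, *The polynomial `X² + Y⁴` captures its primes*, Ann. of Math. (2)
148 (1998), 945–1040 [FriedlanderIwaniecAnnals1998] (= arXiv:math/9811185), §2, Proposition 2.1 with
(2.1)–(2.17) (p. 952: "In this section we state a result of [FI3] in a form which is suitable for the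
proof of the main theorem"); the result of [FI3] being J. Friedlander, H. Iwaniec, *Asymptotic sieve
for primes*, ibid. 1041–1065 [FriedlanderIwaniecASP1998], Theorem 2 (§9, sequences supported on all
integers: (9.1), (9.2), (R₃)) with the modification of Theorem 3 (§10, the sieved bilinear form (B*)).

* `FriedlanderIwaniec1998_prop21_holds` — the named fact
  `Literature.NumberTheory.Sieve.FriedlanderIwaniec1998_prop21` (Proposition 2.1 as printed, in its
  working regime `δ = (log x)^α`, `Δ = x^θ`, `0 < θ < 1/3`, error `O(log log x/log x)`, for ALL sifted
  sequences satisfying (2.1)–(2.15)) is a THEOREM of the tree: it is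
  `fi_asymptotic_sieve_primes_theorem2_loglog` (`AsymptoticSieveForPrimesTheorem2`), whose proof is
  FI's: Theorem 1 of [FriedlanderIwaniecASP1998] with (B*) (proved in the tree, series
  `AsymptoticSieveForPrimes*`, here in the form with saving `(log x)^{-2^{22}}`,
  `fi_asymptotic_sieve_primes_roughWeak_loglog`) applied to `ã_n = μ²(n) a_n` (§9: (9.4)–(9.14), series
  `AsymptoticSieveForPrimesTheorem2*`).

With this, the tree's derivations of parity.S17 from Proposition 2.1
(`friedlanderIwaniecSum_isEquivalent_of_inputs`, `…_of_sq_inputs`, `…_of_consumedInputs`) have one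
named input fewer; the remaining deep inputs are Proposition 3.5/Lemma 3.1 and Proposition 4.1 of
[FriedlanderIwaniecAnnals1998] (see `FriedlanderIwaniecPrimesRough`, `AsymptoticSieveForPrimesTheorem3`).

## References

* J. Friedlander, H. Iwaniec, *The polynomial `X² + Y⁴` captures its primes*, Ann. of Math. (2)
  148 (1998), 945–1040, §2 Proposition 2.1, (2.1)–(2.17). [cite: FriedlanderIwaniecAnnals1998, Proposition 2.1]
* J. Friedlander, H. Iwaniec, *Asymptotic sieve for primes*, Ann. of Math. (2) 148 (1998), 1041–1065,
  §9 Theorem 2, §10 Theorem 3. [cite: FriedlanderIwaniecASP1998, §9 Theorem 2 and §10 Theorem 3]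

## Mathlib / tree search

`lean search 'FriedlanderIwaniec1998_prop21_holds'`: no declaration before this file;
`FriedlanderIwaniec1998_prop21` is the named fact of `FriedlanderIwaniecPrimes.lean`.
-/

noncomputable section

namespace Literature.NumberTheory.Sieve

/-- **FI Proposition 2.1, DISCHARGED** (the asymptotic sieve for primes of [FriedlanderIwaniecASP1998],
Theorems 2–3, in the regime `δ = (log x)^α`, `Δ = x^θ`, `α > 0`, `0 < θ < 1/3`, in which
[FriedlanderIwaniecAnnals1998] §4 applies it): for every sifted sequence `A = (a_n)`, `a_n ≥ 0`, with
(2.1)–(2.15) (`SieveSequence.FI1998SieveHypotheses`) and sieve constant `H` ((2.17),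
`HasDensityConstant`), `S(x) - H A(x) = O(H A(x) log log x/log x)` ((2.16)). One line from the tree:
`fi_asymptotic_sieve_primes_theorem2_loglog`.
[cite: FriedlanderIwaniecAnnals1998, Proposition 2.1, (2.16)-(2.17)] -/
theorem FriedlanderIwaniec1998_prop21_holds : FriedlanderIwaniec1998_prop21 :=
  fun A D P α θ H hα hθ hθ3 hhyp hH =>
    fi_asymptotic_sieve_primes_theorem2_loglog A D P α θ H hα hθ hθ3 hhyp hH

end Literature.NumberTheory.Sieve
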